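import Summits.BirchSwinnertonDyer.BirchSwinnertonDyer.Theorems.KolyvaginRoadThreeCruxIffLeaf
import Summits.BirchSwinnertonDyer.BirchSwinnertonDyer.Theorems.KolyvaginRoadThreeMethod2OddSelmerRank
import Summits.BirchSwinnertonDyer.Rank1Residual.X11b.Three.KolyvaginLine
import Summits.BirchSwinnertonDyer.Rank1Residual.X11b.RingClassFieldNoTorsion
import Literature.NumberTheory.EllipticCurves.BSDSelmerCMPConverseRankOneProofs
import Literature.NumberTheory.EllipticCurves.KolyvaginShaStructureCertificate
import HarnessLib

/-!
# Route `KolyvaginRoadThree`, deciding crux `ZhangSharpFrameAtThreeHL` (item stmt-BirchSwinnertonDyer-19574),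
# skeleton v2y: on the slice `dim_𝔽₃ Sel₃(E/K) = 1`, the CRUX'S OWN CONCLUSION at a frame (some `c₁(n) ≠ 0`)
# already gives stub S1's (`c₁(1) ≠ 0`) — modulo McCallum 1991 Cor. 5.6 in its certificate half
# (cell `bsd-stepL`, ACCEL seat `bsd-stepL-koly3b` g3; `--supports stmt-BirchSwinnertonDyer-19574`, helper)

HONEST FRAMING. Nothing about BSD, Kolyvagin's conjecture or Schneider's conjecture is asserted; the published
inputs (Gross–Zagier, Kolyvagin, modularity, Shimura reciprocity at conductor 1, Gross 1991 §3 ×2, and McCallum 1991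
Cor. 5.6's CERTIFICATE half `McCallum1991_pow_dvd_card_sha_primary_of_certificate`) are named facts of the tree taken
as BINDERS. THEOREMS ONLY (0 definitions, 0 named facts, 0 `sorry`). PARTITION: O2@3 (B10) × A1 × crux 19574 × stub
S1 (slice `dim Sel₃ = 1`) — types-the-object-of (the relation crux|slice ⟹ S1 the planner's probe could not see by
battery, plan g28 01:08:28Z «crux ↛ S1 by battery (S1 pins n = 1: genuinely new content)»); closes: none (T7).

WHAT (`Koly.kolyvaginClass_conductorOne_ne_zero_of_witness_of_finrank_selmer_eq_one`). At an HL frame of a curve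
`(E,3) ∈ X11b` with a (ram) witness (so `ρ̄_{E,3}` onto): if `dim_𝔽₃ Sel₃(E/K) = 1` and SOME Kolyvagin–Heegner datum
of the frame with Kolyvagin-prime conductor `n` has `c₁(n) ≠ 0` (the crux's conclusion at the frame), then EVERY
conductor-1 datum has `c₁(1) ≠ 0` and such a datum exists (S1's conclusion). Mechanism: `Ш(E/K)[3^∞] = 0`
(`dim Sel₃ = 1`, rank one by Kolyvagin, `E(K)[3] = 0`; `primaryComponent_sha_eq_bot_of_card_selmerGroup_eq`); the
witness is a level-1 certificate `3 ∤ P(n)` in `E(K[n])` (McCallum Cor. 4.5, `KolyCert.kolyvaginClass_three_ne_zero_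
iff`), so Cor. 5.6 (certificate half, `M = 0`) gives `3^{2M₀} ∣ #Ш(E/K)[3^∞] = 1`, i.e. `M₀ = 0`: `y_K ∉ 3E(K)`;
then Gross's `P(1) = y_K`, `E(K[1])[3] = 0` and the tower theorem at conductor 1 give `c₁(1) ≠ 0` (as in
`KolyvaginRoadThreeBottomCertificate.lean`). So modulo print, S1 = «the crux on its slice with the witness
normalised to conductor 1»; the normalisation costs exactly McCallum's structure theorem at `Ш[3^∞] = 0`
(`M₀ = M_∞`), as the v2y card says. NO use of `BSDp W 3`, Skinner 2016 or GZK.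

References: [cite: McCallumLMS1991, §4 Cor. 4.5, §5 Lemma 5.1 and Cor. 5.6 (p. 310)] [cite: GrossLMS1991, §3,
Lemma 4.3, §4] [cite: WZhang2014, Thm. 9.1 (r = 1)] [cite: SilvermanAEC2009, Thm. X.4.2].
-/

noncomputable section

open scoped Classical

namespace Summit.BirchSwinnertonDyer.Rank1Residual.X11b.Three.Koly

open WeierstrassCurve NumberField Literature.NumberTheory.EllipticCurves
  Literature.NumberTheory.EllipticCurves.ModularForms
  Literature.NumberTheory.EllipticCurves.Rank1Residual
  Summit.BirchSwinnertonDyer.Rank1Residual Summit.BirchSwinnertonDyer.Rank1Residual.X11b Module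

/-- **On the slice `dim_𝔽₃ Sel₃(E/K) = 1`, a non-zero Kolyvagin class of ANY conductor forces `c₁(1) ≠ 0`.**
Data: `W/ℚ` globally minimal with `(E,3) ∈ X11b` and a (ram) witness; `K` imaginary quadratic with `d_K` odd,
Heegner for `N_E`, `L(E^{d_K},1) ≠ 0`; a frame `(Dt, β, ι)` with `4N ∣ β² − d_K`; the `ZMod 3`-structure of
`H¹(K, E[3])` as an instance binder. PUBLISHED inputs as binders: Gross–Zagier `hGZ`, Kolyvagin `hKo`, modularity
`hmod`, Shimura reciprocity at conductor 1 `hrec`, Gross 1991 §3 `h1 h2`, McCallum Cor. 5.6 (certificate half)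
`hMcC`. HYPOTHESES: `dim_𝔽₃ Sel₃(E/K) = 1` and the crux's conclusion at the frame (`∃ n d, KolSupp n ∧ c₁(n) ≠ 0`).
CONCLUSION: S1's — `∃ d : KolyvaginHeegnerData Dt β ι 1, c₁(1) ≠ 0`. CONDITIONAL on every binder; nothing booked.
[cite: McCallumLMS1991, Cor. 4.5, Lemma 5.1, Cor. 5.6] [cite: GrossLMS1991, Lemma 4.3, §4] -/
theorem kolyvaginClass_conductorOne_ne_zero_of_witness_of_finrank_selmer_eq_one
    (W : WeierstrassCurve ℚ) [W.IsElliptic] [W.IsGloballyMinimal] [NeZero (W.conductorNorm ℤ)]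
    (K : Type) [Field K] [NumberField K]
    (Dt : ModularParametrizationData W (W.conductorNorm ℤ)) (β : ℤ) (ι : K →+* ℂ)
    -- published inputs (named facts of the tree)
    (hGZ : gross_zagier (W.conductorNorm ℤ) W K) (hKo : kolyvagin (W.conductorNorm ℤ) W K)
    (hmod : hasEntireLFunction_rat)
    (hrec : heegnerPointOfConductor_one_galoisConj (W.conductorNorm ℤ) W K)
    (h1 : phi_heegnerPointOfConductor_mem_range_map_ringClassField (W.conductorNorm ℤ) W K)
    (h2 : exists_generator_ringClassGalOver K)
    (hMcC : McCallum1991_pow_dvd_card_sha_primary_of_certificate)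
    -- the pair and the HL frame
    (hX : ClassX11b W 3) (hram : Ram W 3)
    (hK : IsImaginaryQuadratic K) (hodd : Odd (NumberField.discr K))
    (hH : SatisfiesHeegnerHypothesis (W.conductorNorm ℤ) K)
    (hLt : (W.quadraticTwist (NumberField.discr K : ℚ)).entireLFunction 1 ≠ 0)
    (hβ : (4 * (W.conductorNorm ℤ : ℤ)) ∣ β ^ 2 - NumberField.discr K)
    [Module (ZMod 3) (Method2.V3 W K)]
    -- the slice
    (h1dim : finrank (ZMod 3)
      (AddSubgroup.toZModSubmodule 3 (selmerGroup (W.baseChange K) ((3 ^ 1 : ℕ) : ℤ))) = 1)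
    -- the crux's conclusion at the frame: some non-zero Kolyvagin class
    (hwit : ∃ (n : ℕ) (d : KolyvaginHeegnerData Dt β ι n),
      KolyvaginDescent.KolSupp (Zhang2014.IsKolyvaginPrime (W.conductorNorm ℤ) W K 3) n ∧
        d.kolyvaginClass Nat.prime_three 1 ≠ 0) :
    ∃ d : KolyvaginHeegnerData Dt β ι 1, d.kolyvaginClass Nat.prime_three 1 ≠ 0 := by
  haveI : Fact (Nat.Prime 3) := ⟨Nat.prime_three⟩
  have hmult : W.HasMultiplicativeReductionAtPrime 3 := hX.2.2.1
  have hirr : Irr W 3 := hX.2.2.2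
  have hρ : Surj W 3 := surj_of_irr_of_ram W 3 hirr hram
  have hsurj : ∀ m : ℕ, W.HasSurjectiveModNGaloisRep (3 ^ m : ℕ) :=
    Rank1Residual.surjective_pow_three_of_mult_of_tateLine W hmult hρ
  have hCM : ¬ W.HasCM := not_hasCM_of_hasMultiplicativeReductionAtPrime' W hmult
  -- `3 ∤ d_K`; `d_K ∉ {−3, −4}`, `d_K < 0`
  obtain ⟨h3d, _⟩ := not_dvd_discr_and_not_dvd_torsionOrder_of_heegner hK hH (p := 3) (by decide)
    (dvd_conductorNorm_of_classX11b hX)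
  have h3 : NumberField.discr K ≠ -3 := by
    intro h
    exact h3d (h ▸ ⟨-1, by norm_num⟩)
  have h4 : NumberField.discr K ≠ -4 := by
    intro h
    rw [h] at hodd
    exact (Int.not_odd_iff_even.mpr ⟨-2, by norm_num⟩) hodd
  have hDneg : NumberField.discr K < 0 := by
    have hND : IsCoprime (W.conductorNorm ℤ : ℤ) (NumberField.discr K) := by
      have h := Literature.SatisfiesHeegnerHypothesis.coprime_discr hK.1 hH
      refine Int.isCoprime_iff_gcd_eq_one.mpr ?_
      rw [Int.gcd_eq_natAbs, Int.natAbs_natCast]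
      exact h
    have hlt := discr_lt_neg_four_of_isCoprime_of_dvd_sq_sub hK hND (dvd_conductorNorm_of_classX11b hX) hβ
    omega
  -- THE Heegner point `P = y_K ∈ E(K)` of the frame
  obtain ⟨H, hHβ⟩ := exists_heegnerDatum (W.conductorNorm ℤ) hDneg hβ
  obtain ⟨P, hP⟩ := heegnerPointComplex_mem_range_map_holds (W.conductorNorm ℤ) W K hK hH Dt H ι
  have hPinf : ¬ IsOfFinAddOrder P :=
    not_isOfFinAddOrder_of_heegner_of_analyticRank_eq_one W (W.conductorNorm ℤ) K Dt H ι P hGZ hmod hX.1 hK hH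
      hLt hP
  obtain ⟨hrank, hSha⟩ := hKo hK hH ⟨Dt, H, ι, hP⟩ hPinf
  haveI : Finite (W.baseChange K).sha := hSha
  have hbot := torsionBy_eq_bot_of_isImaginaryQuadratic_of_hasIrreducibleModPGaloisRep W K hK Nat.prime_three hirr
  haveI : Module.Finite ℤ (W.baseChange K).toAffine.Point := (W.baseChange K).module_finite_point_holds
  obtain ⟨M₀, x₀, hx₀, hmax⟩ := exists_pow_smul_eq_and_forall_ne hPinf (p := 3) (by norm_num)
  have hdiv : ∃ Q : (W.baseChange K).toAffine.Point, ((3 ^ M₀ : ℕ) : ℤ) • Q = P :=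
    ⟨x₀, by rw [natCast_zsmul]; exact hx₀⟩
  have hndiv : ¬ ∃ Q : (W.baseChange K).toAffine.Point, ((3 ^ (M₀ + 1) : ℕ) : ℤ) • Q = P := by
    rintro ⟨Q, hQ⟩
    exact hmax Q (by rw [← natCast_zsmul]; exact hQ)
  -- the slice: `Ш(E/K)[3^∞] = 0`
  obtain ⟨s, hs⟩ := exists_natCard_selmerGroup_eq_pow (W.baseChange K) 3
  have hfin : finrank (ZMod 3)
      (AddSubgroup.toZModSubmodule 3 (selmerGroup (W.baseChange K) ((3 ^ 1 : ℕ) : ℤ))) = s :=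
    Method2.finrank_selmer_eq_of_natCard_eq_pow (W.baseChange K) hs
  have hs1 : s = 1 := by rw [← hfin, h1dim]
  have hSel3 : Nat.card ((W.baseChange K).selmerGroup ((3 : ℕ) : ℤ)) = 3 := by
    rw [hs, hs1, pow_one]
  have ht : Nat.card (AddSubgroup.torsionBy (W.baseChange K).toAffine.Point ((3 : ℕ) : ℤ)) = 1 := by
    rw [hbot, AddSubgroup.card_bot]
  have hShabot : AddCommGroup.primaryComponent (W.baseChange K).sha 3 = ⊥ :=
    primaryComponent_sha_eq_bot_of_card_selmerGroup_eq (W.baseChange K) 3 hSel3 hrank ht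
  have hcard1 : Nat.card (AddCommGroup.primaryComponent (W.baseChange K).sha 3) = 1 := by
    rw [hShabot, AddSubgroup.card_bot]
  -- a conductor-1 datum and `P(1) = y_K` in `E(K̄)`
  obtain ⟨d₁⟩ := Summit.BirchSwinnertonDyer.BirchSwinnertonDyer.Theorems.nonempty_kolyvaginHeegnerData_of_grossCM
    h1 h2 hK hH Dt β ι hβ squarefree_one (by simp)
  have hPd : d₁.toGeomPoints d₁.derivedPoint = toGeomPoints (W.baseChange K) P :=
    KolyvaginBottom.toGeomPoints_derivedPoint_one_eq hrec hK hH hP d₁ hHβ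
  -- the witness is a level-1 certificate; Cor. 5.6 (certificate half, M = 0) gives `3^{2M₀} ∣ 1`
  obtain ⟨n, dn, hsupp, hne⟩ := hwit
  have hcertn : ¬ PDiv dn 3 1 := ((KolyCert.kolyvaginClass_three_ne_zero_iff dn hK hsupp.1.ne_zero hρ 1).mp hne).2
  have hcertn' : ¬ ∃ Q : (W.baseChange (ringClassField K ι n)).toAffine.Point,
      ((3 ^ (0 + 1) : ℕ) : ℤ) • Q = dn.derivedPoint := by
    rw [Nat.zero_add]
    exact hcertn
  have hℓ : ∀ ℓ ∈ n.primeFactors, Zhang2014.IsKolyvaginPrime (W.conductorNorm ℤ) W K 3 ℓ ∧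
      0 + 1 ≤ Zhang2014.kolyvaginIndex W 3 ℓ :=
    fun q hq ↦ ⟨hsupp.2 q hq, by rw [Nat.zero_add]; exact (hsupp.2 q hq).2.2.2.2.2⟩
  have hdvd := hMcC W hCM K hK h3 h4 hH 3 (by norm_num) hsurj Dt β ι d₁ P hPd hPinf M₀ hdiv hndiv n 0 dn hsupp.1
    hℓ hcertn'
  rw [hcard1, Nat.sub_zero] at hdvd
  have hM₀ : M₀ = 0 := by
    have h9 : 3 ^ (2 * M₀) = 1 := Nat.eq_one_of_dvd_one hdvd
    have := (Nat.pow_eq_one.mp h9)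
    omega
  -- hence `y_K ∉ 3E(K)`, and `c₁(1) ≠ 0` by the tower theorem at conductor 1
  have hndiv1 : ¬ ∃ Q : (W.baseChange K).toAffine.Point, ((3 ^ 1 : ℕ) : ℤ) • Q = P := by
    rw [hM₀, zero_add] at hndiv
    exact hndiv
  obtain ⟨P₀, -, hP₀⟩ := heegnerSystem_exists_isHeegnerPoint_map_eq_derivedPoint_one hrec hK hH d₁
  have hP₀P : P₀ = P := KolyvaginBottom.eq_of_map_eq_heegnerPointComplex hrec hK hH d₁ hHβ hP hP₀
  rw [hP₀P] at hP₀
  have htor : ∀ R : (W.baseChange (ringClassField K ι 1)).toAffine.Point, ((3 ^ 1 : ℕ) : ℤ) • R = 0 → R = 0 :=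
    fun R hR ↦ RingClassNoTorsion.eq_zero_of_zsmul_pow_eq_zero_ringClassField W hK ι one_ne_zero Nat.prime_three
      (by norm_num) hρ 1 R hR
  have hcert : ¬ PDiv d₁ 3 1 := fun h ↦ hndiv1 ((pDiv_one_iff_exists_zsmul_eq hK d₁ P hP₀ 3 1 htor).mp h)
  let d : (m : ℕ) → m ∣ 1 → KolyvaginHeegnerData Dt β ι m := fun m hm ↦
    if h : m = 1 then h ▸ d₁ else (h (Nat.dvd_one.mp hm)).elim
  have hd : d 1 dvd_rfl = d₁ := by
    show (if h : (1 : ℕ) = 1 then h ▸ d₁ else _) = d₁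
    rw [dif_pos rfl]
  have hcert' : ¬ PDiv (d 1 dvd_rfl) 3 1 := by rwa [hd]
  have hne₁ := KolyCert.kolyvaginClass_three_ne_zero_of_tower_not_pDiv W K Dt β ι hmult hρ hK hH
    (KolyvaginDescent.kolSupp_one _) d hcert'
  rw [hd] at hne₁
  exact ⟨d₁, hne₁⟩

end Summit.BirchSwinnertonDyer.Rank1Residual.X11b.Three.Koly

end
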